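import Mathlib
import Summits.Ventures.FusionMHD.Models.CerfonFreidbergIterLikeQHalfMercier
import Summits.Ventures.FusionMHD.Models.CerfonFreidbergIterLikeQHalfForceBalance
import Summits.Ventures.FusionMHD.Models.CerfonFreidbergIterLikeQHalfResistive
import HarnessLib

/-!
# Ventures/FusionMHD — Models/CerfonFreidbergIterLikeQHalfMercierDI.lean: ★ THE PRINTED GGJ IDEAL-INTERCHANGE INDEX `D_I` AT `ψ_N = 1/2` OF THE
# Cerfon–Freidberg ITER-like MODEL FLUX, CERTIFIED FOR EVERY `F ≠ 0` — `D_I(F) = −M₂/(4Pd²) + M₀/(4F²Pd²)`, `D_I(3/5) ∈ [−1.0217, −1.0212]`,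
# and `D_I < 0 ⟺` Mercier (8.134)

HONEST FRAMING (LADDER-GRIDFUSION three columns; CF rung; F2 item R2 / F3 R3 input «D_I of a computed-shape surface» (model-6 F3-SCOPING), rider of the booked
row «F2.R2-CF-MERCIER-IMPLICIT», LOW).
* CERTIFIED (kernel, this file + imports; axioms standard): for THE flux of record and the surface `u₀` (`ψ_N = 1/2`), with model-7 g6's theorem
  `ggjDI_eq_registerForm` (the PRINTED GGJ ideal index of the volume/Hamada relabelling of Jardin's record, Zheng (2.62), `= −rf/(4F²Pd²)` in six full-loop
  registers), the mirror halving `registers_two_mul`, the degree-two homogeneity `mercierRegisterForm_smul`, and model-7 g7's `registerForm_eq`,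
  `M2v_bounds`, `M0v_bounds`, `shear_half_bounds`: **`ggjDI_half_eq`** — `D_I = −(F²·M2v − M0v)/(4F²·Pd²)` (`Pd` = the `[0, π]` shear register; the
  hypothesis `⟨B²/|∇U|²⟩ ≠ 0` of g6's theorem is DISCHARGED by `LevelLoop.ggjData_gB2_pos`, the shear hypothesis by ★ #153); **`ggjDI_half_neg_iff`** —
  `D_I < 0 ↔ (ggjData F u₀).MercierCriterion`; **`ggjDI_half_bounds_three_fifths`** — at `F = 3/5`: `−1.0217 ≤ D_I ≤ −1.0212` (kernel arithmetic `[−1.021656, −1.021298]`).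
* VALIDATED (never used): float `D_I(ψ_N = 1/2, F = 3/5) = −1.021476` (model-7 g6 cf_registers.py; g7 genqm), lineage-1 `mercierD = D_I + 1/4 = −0.77148`.
* MODELLED: analytic Cerfon–Freidberg family (ideal MHD, Solov'ev profiles `A = 0`); `D_I` is an index of a MODEL surface — nothing about a device or stability
  («`D_I < 0`» is the MODEL's necessary interchange criterion, never «stable»).
Typer/prover: gridfusion-model-7 (g7), 2026-08-28.  Citations: Zheng 2015 §2.3 (2.62) [Zheng2015]; Jardin 2010 §8.5.4 (8.134) [Jardin2010]; Glasser–Greene–Johnson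
1975 [GlasserGreeneJohnson1975].
-/

noncomputable section

open Set MeasureTheory intervalIntegral
open Literature.MathematicalPhysics.MHD Literature.MathematicalPhysics.MHD.CerfonFreidberg Literature.MathematicalPhysics.MHD.GradShafranov
  Literature.MathematicalPhysics.MHD.FluxGeometry Literature.MathematicalPhysics.MHD.Mercier.FluxForm
open Summit.Ventures.FusionMHD.Models.PolarRay

set_option autoImplicit false

namespace Summit.Ventures.FusionMHD.Models.CFIterLike.QHalf

/-- The `[0, π]` shear register `Pd` is positive (★ #153), hence its full-loop double is nonzero. -/
theorem shear_full_ne_zero :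
    (∫ θ in (0 : ℝ)..(2 * Real.pi), polarKernelDs Xa Dfield F2field θ (rayRadius U Xa 0 u₀ θ) / Dfield θ (rayRadius U Xa 0 u₀ θ)) ≠ 0 := by
  have h := shear_half_bounds.1
  have e := (registers_two_mul (u := u₀) (F := 1)).1
  norm_num [shearTotLo] at h
  rw [e]
  exact mul_ne_zero two_ne_zero (by change (∫ θ in (0 : ℝ)..Real.pi, polarKernelDs Xa Dfield F2field θ (ρ θ) / Dfield θ (ρ θ)) ≠ 0; linarith)

/-- `⟨B²/|∇U|²⟩ ≠ 0` on the surface (positive kernel; model-7 g6's `LevelLoop.ggjData_gB2_pos`). -/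
theorem ggjData_gB2_ne_zero (F : ℝ) : (ggjData F u₀).gB2 ≠ 0 := by
  have h := levelLoop.ggjData_gB2_pos F 1 box_facts.1 box_facts.2 box_factsG (fun k hk => continuousOn_Gfield_box hk) u₀_mem
  exact h.ne'

/-- **THE PRINTED GGJ `D_I` AT `ψ_N = 1/2` FOR EVERY `F ≠ 0`**: `D_I = −(F²·M2v − M0v)/(4F²·Pd²)` with `Pd` the certified `[0, π]` shear register.
[cite: Zheng2015, §2.3 eq. (2.62)] -/
theorem ggjDI_half_eq (F : ℝ) (hF : F ≠ 0) (sB2 B2 : ℝ) :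
    ((ggjData F u₀).relabel (ggjData F u₀).V' (ggjData F u₀).V'').ggjDI sB2 B2
      = -(F ^ 2 * M2v - M0v)
        / (4 * F ^ 2 * (∫ θ in (0 : ℝ)..Real.pi, polarKernelDs Xa Dfield F2field θ (ρ θ) / Dfield θ (ρ θ)) ^ 2) := by
  have h := ggjDI_eq_registerForm u₀_mem F hF shear_full_ne_zero (ggjData_gB2_ne_zero F) sB2 B2
  obtain ⟨e1, e2, e3, e4, e5, e6, -, -⟩ := registers_two_mul (u := u₀) (F := F)
  rw [e1, e2, e3, e4, e5, e6, mercierRegisterForm_smul] at h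
  rw [h]
  change -((2 : ℝ) ^ 2 * mercierRegisterForm F 1
      (∫ θ in (0 : ℝ)..Real.pi, polarKernelDs Xa Dfield F2field θ (ρ θ) / Dfield θ (ρ θ))
      (∫ θ in (0 : ℝ)..Real.pi, volKernelDs Xa Dfield F2field θ (ρ θ) / Dfield θ (ρ θ))
      (∫ θ in (0 : ℝ)..Real.pi, invGradKernel Xa Dfield Gfield θ (ρ θ))
      (∫ θ in (0 : ℝ)..Real.pi, sigmaSqKernel F Xa Dfield Gfield θ (ρ θ))
      (∫ θ in (0 : ℝ)..Real.pi, bsqGradKernel F Xa Dfield Gfield θ (ρ θ))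
      (∫ θ in (0 : ℝ)..Real.pi, invBsqKernel F Xa Dfield Gfield θ (ρ θ)))
    / (4 * F ^ 2 * (2 * ∫ θ in (0 : ℝ)..Real.pi, polarKernelDs Xa Dfield F2field θ (ρ θ) / Dfield θ (ρ θ)) ^ 2) = _
  rw [registerForm_eq]
  have hP : (∫ θ in (0 : ℝ)..Real.pi, polarKernelDs Xa Dfield F2field θ (ρ θ) / Dfield θ (ρ θ)) ≠ 0 := by
    have h1 := shear_half_bounds.1; norm_num [shearTotLo] at h1; exact (by linarith : (0 : ℝ) < _).ne'
  field_simp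

/-- **`D_I < 0` AT `ψ_N = 1/2` ⟺ MERCIER (8.134) HOLDS THERE** (for every `F ≠ 0`; `Pd > 0` certified). [cite: Zheng2015, §2.3 eq. (2.62)] -/
theorem ggjDI_half_neg_iff (F : ℝ) (hF : F ≠ 0) (sB2 B2 : ℝ) :
    ((ggjData F u₀).relabel (ggjData F u₀).V' (ggjData F u₀).V'').ggjDI sB2 B2 < 0 ↔ (ggjData F u₀).MercierCriterion := by
  rw [ggjDI_half_eq F hF, mercier_half_iff_quadratic]
  have h1 := shear_half_bounds.1; norm_num [shearTotLo] at h1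
  have hden : 0 < 4 * F ^ 2 * (∫ θ in (0 : ℝ)..Real.pi, polarKernelDs Xa Dfield F2field θ (ρ θ) / Dfield θ (ρ θ)) ^ 2 := by
    have hF2 : 0 < F ^ 2 := by positivity
    have hP2 : 0 < (∫ θ in (0 : ℝ)..Real.pi, polarKernelDs Xa Dfield F2field θ (ρ θ) / Dfield θ (ρ θ)) ^ 2 := by
      apply pow_pos; linarith
    positivity
  rw [neg_div, neg_lt_zero, div_pos_iff_of_pos_right hden]

/-- **★ `D_I(ψ_N = 1/2, F = 3/5) ∈ [−1.0217, −1.0212]`** (float truth `−1.021476`). [cite: Zheng2015, §2.3 eq. (2.62)] -/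
theorem ggjDI_half_bounds_three_fifths (sB2 B2 : ℝ) :
    (-(10217 / 10000) : ℝ) ≤ ((ggjData (3 / 5) u₀).relabel (ggjData (3 / 5) u₀).V' (ggjData (3 / 5) u₀).V'').ggjDI sB2 B2
    ∧ ((ggjData (3 / 5) u₀).relabel (ggjData (3 / 5) u₀).V' (ggjData (3 / 5) u₀).V'').ggjDI sB2 B2 ≤ (-(10212 / 10000) : ℝ) := by
  rw [ggjDI_half_eq (3 / 5) (by norm_num)]
  obtain ⟨h1, h2, -⟩ := shear_half_bounds
  norm_num [shearTotLo, shearTotHi] at h1 h2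
  obtain ⟨m21, m22⟩ := M2v_bounds
  obtain ⟨m01, m02⟩ := M0v_bounds
  set P := ∫ θ in (0 : ℝ)..Real.pi, polarKernelDs Xa Dfield F2field θ (ρ θ) / Dfield θ (ρ θ)
  have hP0 : 0 < P := by linarith
  have hP2lo : (996862376063 / 10000000000 : ℝ) ^ 2 ≤ P ^ 2 := pow_le_pow_left₀ (by norm_num) h1 2
  have hP2hi : P ^ 2 ≤ (249216162433 / 2500000000 : ℝ) ^ 2 := pow_le_pow_left₀ hP0.le h2 2
  have hden : 0 < 4 * ((3 : ℝ) / 5) ^ 2 * P ^ 2 := by positivity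
  constructor
  · rw [le_div_iff₀ hden]; nlinarith [hP2lo, hP2hi, m21, m22, m01, m02]
  · rw [div_le_iff₀ hden]; nlinarith [hP2lo, hP2hi, m21, m22, m01, m02]

end Summit.Ventures.FusionMHD.Models.CFIterLike.QHalf

end
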